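import Literature.NumberTheory.LFunctions.YoshidaWindowGramEnclosure
import HarnessLib

/-!
# Format C, design C∞: kernel envelope — the polar and prime parts of Yoshida's Gram matrix

Route context: Fourier–Galerkin / Schur-complement certificates of Weil positivity on a window ("format C";
cell memo `run/shared/lean/pub/rh-explicit/rh-explicit-weil-10/KERNEL-LEVER.md` §18 (the `Uq` clause of the deflated
certificate with limit data); supporting stmt-RiemannHypothesis-0098; seat rh-explicit-weil-10).

First of three files establishing the ENVELOPE of Yoshida's matrix coefficients `G(n,m) = gramCoeff a n m`
((5.15)/(5.16)): `O(1/|n − m|)` off the diagonal, `O(log(2 + |n|))` on it.  Here the polar and prime parts: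

* `abs_polarCoeff_le`: `|POL(n,m)| ≤ (16/a)(e^{a/2} − e^{−a/2})²/((1 + 2|ω_n|)(1 + 2|ω_m|))`, hence
  `≤ (8/π)(e^{a/2} − e^{−a/2})²/|n − m|` off the diagonal (`abs_polarCoeff_le_of_ne`) and `≤ (16/a)(…)²` on it;
* `abs_incrCoeff_le_of_ne`: `|K_t(n,m)| ≤ (2/π)/|n − m|`; `abs_incrCoeff_diag_sub_two_le`: `|K_t(n,n) − 2| ≤ 2` (`0 ≤ t ≤ 2a`);
* `abs_primeCoeff_le_of_ne`: `|PRM(n,m)| ≤ (2/π)S_Λ/|n − m|`, `abs_primeCoeff_diag_le`: `|PRM(n,n)| ≤ 2S_Λ`,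
  `S_Λ = Σ_{log k<2a} Λ(k)k^{-1/2}`.

Sequels: `WeilFormatCKernelEnvelopeArch` (archimedean part), `WeilFormatCKernelEnvelope` (assembly + sector kernels).
Elementary real analysis on the printed formulas; standard axioms; no definitions; no RH claim.
-/

set_option autoImplicit false
-- `Summit.RiemannHypothesis.RiemannHypothesis.…` is the layout-mandated namespace (summit = problem name).
set_option linter.dupNamespace false

noncomputable section

open Complex Finset
open scoped Real BigOperators ArithmeticFunction.vonMangoldt

namespace Summit.RiemannHypothesis.RiemannHypothesis.Theorems.WeilFormatC

open Literature.NumberTheory.LFunctions Literature.NumberTheory.LFunctions.Yoshida1992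
open Literature.Analysis.SpecialFunctions Literature.Analysis.SpecialFunctions.Complex

variable {a : ℝ}

/-! ## The polar coefficient -/

/-- The core inequality of the polar bound: `|1 − 4uv|/((1 + 4u²)(1 + 4v²)) ≤ 4/((1 + 2|u|)(1 + 2|v|))`. -/
theorem abs_polar_core_le (u v : ℝ) :
    |1 - 4 * u * v| / ((1 + 4 * u ^ 2) * (1 + 4 * v ^ 2)) ≤ 4 / ((1 + 2 * |u|) * (1 + 2 * |v|)) := by
  have hx : 0 ≤ |u| := abs_nonneg u
  have hy : 0 ≤ |v| := abs_nonneg v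
  rw [div_le_div_iff₀ (by positivity) (by positivity)]
  have h1 : |1 - 4 * u * v| ≤ 1 + 4 * |u| * |v| := by
    calc |1 - 4 * u * v| ≤ |(1 : ℝ)| + |4 * u * v| := abs_sub _ _
      _ = 1 + 4 * |u| * |v| := by
          rw [abs_one, abs_mul, abs_mul, abs_of_pos (by norm_num : (0 : ℝ) < 4)]
  have hu2 : u ^ 2 = |u| ^ 2 := (sq_abs u).symm
  have hv2 : v ^ 2 = |v| ^ 2 := (sq_abs v).symm
  rw [hu2, hv2]
  calc |1 - 4 * u * v| * ((1 + 2 * |u|) * (1 + 2 * |v|))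
      ≤ (1 + 4 * |u| * |v|) * ((1 + 2 * |u|) * (1 + 2 * |v|)) :=
        mul_le_mul_of_nonneg_right h1 (by positivity)
    _ ≤ ((1 + 2 * |u|) * (1 + 2 * |v|)) * ((1 + 2 * |u|) * (1 + 2 * |v|)) := by
        refine mul_le_mul_of_nonneg_right ?_ (by positivity)
        nlinarith [mul_nonneg hx hy]
    _ ≤ 4 * ((1 + 4 * |u| ^ 2) * (1 + 4 * |v| ^ 2)) := by
        have e1 : (1 + 2 * |u|) ^ 2 ≤ 2 * (1 + 4 * |u| ^ 2) := by nlinarith [sq_nonneg (2 * |u| - 1)]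
        have e2 : (1 + 2 * |v|) ^ 2 ≤ 2 * (1 + 4 * |v| ^ 2) := by nlinarith [sq_nonneg (2 * |v| - 1)]
        have e0 : ((1 + 2 * |u|) * (1 + 2 * |v|)) * ((1 + 2 * |u|) * (1 + 2 * |v|))
            = (1 + 2 * |u|) ^ 2 * (1 + 2 * |v|) ^ 2 := by ring
        rw [e0]
        calc (1 + 2 * |u|) ^ 2 * (1 + 2 * |v|) ^ 2 ≤ (2 * (1 + 4 * |u| ^ 2)) * (2 * (1 + 4 * |v| ^ 2)) :=
              mul_le_mul e1 e2 (by positivity) (by positivity)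
          _ = 4 * ((1 + 4 * |u| ^ 2) * (1 + 4 * |v| ^ 2)) := by ring

/-- **Polar envelope**: `|POL(n,m)| ≤ (16/a)(e^{a/2} − e^{−a/2})²/((1 + 2|ω_n|)(1 + 2|ω_m|))` (`a > 0`). -/
theorem abs_polarCoeff_le (ha : 0 < a) (n m : ℤ) :
    |polarCoeff a n m| ≤ 16 / a * (Real.exp (a / 2) - Real.exp (-(a / 2))) ^ 2 /
      ((1 + 2 * |freq a n|) * (1 + 2 * |freq a m|)) := by
  unfold polarCoeff
  have hD : 0 < (1 + 4 * freq a n ^ 2) * (1 + 4 * freq a m ^ 2) := by positivity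
  rw [abs_div, abs_mul, abs_mul, abs_mul, abs_neg_one_zpow, one_mul, abs_of_pos (by positivity : (0 : ℝ) < 4 / a),
    abs_of_nonneg (sq_nonneg _), abs_of_pos hD]
  have e1 : 4 / a * (Real.exp (a / 2) - Real.exp (-(a / 2))) ^ 2 * |1 - 4 * freq a n * freq a m| /
      ((1 + 4 * freq a n ^ 2) * (1 + 4 * freq a m ^ 2))
      = 4 / a * (Real.exp (a / 2) - Real.exp (-(a / 2))) ^ 2 *
        (|1 - 4 * freq a n * freq a m| / ((1 + 4 * freq a n ^ 2) * (1 + 4 * freq a m ^ 2))) := by ring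
  have e2 : 16 / a * (Real.exp (a / 2) - Real.exp (-(a / 2))) ^ 2 / ((1 + 2 * |freq a n|) * (1 + 2 * |freq a m|))
      = 4 / a * (Real.exp (a / 2) - Real.exp (-(a / 2))) ^ 2 * (4 / ((1 + 2 * |freq a n|) * (1 + 2 * |freq a m|))) := by
    ring
  rw [e1, e2]
  exact mul_le_mul_of_nonneg_left (abs_polar_core_le _ _) (by positivity)

/-- `ω_n − ω_m = π(n − m)/a`. -/
theorem freq_sub_freq (a : ℝ) (n m : ℤ) : freq a n - freq a m = π * ((n : ℝ) - m) / a := by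
  unfold freq; ring

/-- Off the diagonal the frequency product dominates the index gap:
`1/((1 + 2|ω_n|)(1 + 2|ω_m|)) ≤ (a/(2π))/|n − m|` (`a > 0`, `n ≠ m`). -/
theorem inv_freq_prod_le (ha : 0 < a) {n m : ℤ} (hnm : n ≠ m) :
    1 / ((1 + 2 * |freq a n|) * (1 + 2 * |freq a m|)) ≤ a / (2 * π) / |(n : ℝ) - m| := by
  have hgap : 0 < |(n : ℝ) - m| := by
    rw [abs_pos, sub_ne_zero]
    exact_mod_cast hnm
  have hkey : 2 * π / a * |(n : ℝ) - m| ≤ (1 + 2 * |freq a n|) * (1 + 2 * |freq a m|) := by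
    have h1 : |freq a n - freq a m| ≤ |freq a n| + |freq a m| := abs_sub _ _
    have h2 : |freq a n - freq a m| = π / a * |(n : ℝ) - m| := by
      rw [freq_sub_freq, abs_div, abs_mul, abs_of_pos Real.pi_pos, abs_of_pos ha]; ring
    have hu := abs_nonneg (freq a n)
    have hv := abs_nonneg (freq a m)
    calc 2 * π / a * |(n : ℝ) - m| = 2 * |freq a n - freq a m| := by rw [h2]; ring
      _ ≤ 2 * (|freq a n| + |freq a m|) := by linarith
      _ ≤ (1 + 2 * |freq a n|) * (1 + 2 * |freq a m|) := by nlinarith [mul_nonneg hu hv]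
  rw [div_div, div_le_div_iff₀ (by positivity) (by positivity), one_mul]
  calc 2 * π * |(n : ℝ) - m| = a * (2 * π / a * |(n : ℝ) - m|) := by field_simp
    _ ≤ a * ((1 + 2 * |freq a n|) * (1 + 2 * |freq a m|)) := mul_le_mul_of_nonneg_left hkey ha.le

/-- **Polar envelope off the diagonal**: `|POL(n,m)| ≤ (8/π)(e^{a/2} − e^{−a/2})²/|n − m|` (`a > 0`, `n ≠ m`). -/
theorem abs_polarCoeff_le_of_ne (ha : 0 < a) {n m : ℤ} (hnm : n ≠ m) :
    |polarCoeff a n m| ≤ 8 / π * (Real.exp (a / 2) - Real.exp (-(a / 2))) ^ 2 / |(n : ℝ) - m| := by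
  have h := abs_polarCoeff_le ha n m
  have h2 := inv_freq_prod_le ha hnm
  have hE : 0 ≤ 16 / a * (Real.exp (a / 2) - Real.exp (-(a / 2))) ^ 2 := by positivity
  calc |polarCoeff a n m| ≤ 16 / a * (Real.exp (a / 2) - Real.exp (-(a / 2))) ^ 2 *
        (1 / ((1 + 2 * |freq a n|) * (1 + 2 * |freq a m|))) := by rw [mul_one_div]; exact h
    _ ≤ 16 / a * (Real.exp (a / 2) - Real.exp (-(a / 2))) ^ 2 * (a / (2 * π) / |(n : ℝ) - m|) :=
        mul_le_mul_of_nonneg_left h2 hE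
    _ = 8 / π * (Real.exp (a / 2) - Real.exp (-(a / 2))) ^ 2 / |(n : ℝ) - m| := by
        field_simp
        ring

/-- **Polar envelope on the diagonal**: `|POL(n,n)| ≤ (16/a)(e^{a/2} − e^{−a/2})²` (`a > 0`). -/
theorem abs_polarCoeff_diag_le (ha : 0 < a) (n : ℤ) :
    |polarCoeff a n n| ≤ 16 / a * (Real.exp (a / 2) - Real.exp (-(a / 2))) ^ 2 := by
  refine (abs_polarCoeff_le ha n n).trans ?_
  refine div_le_self (by positivity) ?_
  nlinarith [abs_nonneg (freq a n)]

/-! ## The increment kernel and the prime coefficient -/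

/-- **Increment kernel off the diagonal**: `|K_t(n,m)| ≤ (2/π)/|n − m|` (`n ≠ m`, any `t`). -/
theorem abs_incrCoeff_le_of_ne (a t : ℝ) {n m : ℤ} (hnm : n ≠ m) :
    |incrCoeff a t n m| ≤ 2 / π / |(n : ℝ) - m| := by
  have hgap : 0 < |(n : ℝ) - m| := by
    rw [abs_pos, sub_ne_zero]
    exact_mod_cast hnm
  unfold incrCoeff
  rw [if_neg hnm, abs_div, abs_mul, abs_neg, abs_neg_one_zpow, one_mul, abs_mul, abs_of_pos Real.pi_pos, div_div]
  refine div_le_div_of_nonneg_right ?_ (by positivity)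
  calc |Real.sin (freq a m * t) - Real.sin (freq a n * t)|
      ≤ |Real.sin (freq a m * t)| + |Real.sin (freq a n * t)| := abs_sub _ _
    _ ≤ 1 + 1 := add_le_add (Real.abs_sin_le_one _) (Real.abs_sin_le_one _)
    _ = 2 := by norm_num

/-- **Increment kernel on the diagonal**: `|K_t(n,n) − 2| ≤ 2` for `0 ≤ t ≤ 2a` (`a > 0`). -/
theorem abs_incrCoeff_diag_sub_two_le (ha : 0 < a) {t : ℝ} (ht0 : 0 ≤ t) (ht : t ≤ 2 * a) (n : ℤ) :
    |incrCoeff a t n n - 2| ≤ 2 := by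
  unfold incrCoeff
  rw [if_pos rfl]
  have h1 : |1 - t / (2 * a)| ≤ 1 := by
    rw [abs_le]
    constructor
    · have : t / (2 * a) ≤ 1 := by rw [div_le_one (by positivity)]; exact ht
      linarith
    · have : 0 ≤ t / (2 * a) := by positivity
      linarith
  have h2 : |Real.cos (freq a n * t)| ≤ 1 := Real.abs_cos_le_one _
  calc |2 - 2 * (1 - t / (2 * a)) * Real.cos (freq a n * t) - 2|
      = 2 * (|1 - t / (2 * a)| * |Real.cos (freq a n * t)|) := by
        rw [← abs_mul, show 2 - 2 * (1 - t / (2 * a)) * Real.cos (freq a n * t) - 2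
          = -(2 * ((1 - t / (2 * a)) * Real.cos (freq a n * t))) by ring, abs_neg, abs_mul,
          abs_of_pos (by norm_num : (0 : ℝ) < 2)]
    _ ≤ 2 * (1 * 1) := by
        refine mul_le_mul_of_nonneg_left ?_ (by norm_num)
        exact mul_le_mul h1 h2 (abs_nonneg _) zero_le_one
    _ = 2 := by norm_num

/-- The total prime weight of the window `S_Λ(a) = Σ_{log k<2a} Λ(k)k^{-1/2}` is nonnegative
(termwise `0 ≤ Λ(k)k^{-1/2}`, cf. `OddBartaFloor.vonMangoldt_div_sqrt_nonneg`). -/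
theorem sum_vonMangoldt_div_sqrt_nonneg (a : ℝ) :
    0 ≤ ∑ k ∈ weilPrimeIndex a, (Λ k : ℝ) / Real.sqrt k :=
  Finset.sum_nonneg fun _ _ ↦ div_nonneg ArithmeticFunction.vonMangoldt_nonneg (Real.sqrt_nonneg _)

/-- **Prime envelope off the diagonal**: `|PRM(n,m)| ≤ (2/π)S_Λ/|n − m|` (`n ≠ m`). -/
theorem abs_primeCoeff_le_of_ne (a : ℝ) {n m : ℤ} (hnm : n ≠ m) :
    |primeCoeff a n m| ≤ 2 / π * (∑ k ∈ weilPrimeIndex a, (Λ k : ℝ) / Real.sqrt k) / |(n : ℝ) - m| := by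
  unfold primeCoeff
  simp_rw [if_neg hnm, sub_zero]
  calc |∑ k ∈ weilPrimeIndex a, (Λ k : ℝ) / Real.sqrt k * incrCoeff a (Real.log k) n m|
      ≤ ∑ k ∈ weilPrimeIndex a, |(Λ k : ℝ) / Real.sqrt k * incrCoeff a (Real.log k) n m| :=
        Finset.abs_sum_le_sum_abs _ _
    _ ≤ ∑ k ∈ weilPrimeIndex a, (Λ k : ℝ) / Real.sqrt k * (2 / π / |(n : ℝ) - m|) :=
        Finset.sum_le_sum fun k _ ↦ by
          rw [abs_mul, abs_of_nonneg (div_nonneg ArithmeticFunction.vonMangoldt_nonneg (Real.sqrt_nonneg _))]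
          exact mul_le_mul_of_nonneg_left (abs_incrCoeff_le_of_ne a _ hnm) (div_nonneg ArithmeticFunction.vonMangoldt_nonneg (Real.sqrt_nonneg _))
    _ = 2 / π * (∑ k ∈ weilPrimeIndex a, (Λ k : ℝ) / Real.sqrt k) / |(n : ℝ) - m| := by
        rw [← Finset.sum_mul]; ring

/-- **Prime envelope on the diagonal**: `|PRM(n,n)| ≤ 2S_Λ` (`a > 0`). -/
theorem abs_primeCoeff_diag_le (ha : 0 < a) (n : ℤ) :
    |primeCoeff a n n| ≤ 2 * ∑ k ∈ weilPrimeIndex a, (Λ k : ℝ) / Real.sqrt k := by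
  unfold primeCoeff
  simp only [if_true]
  calc |∑ k ∈ weilPrimeIndex a, (Λ k : ℝ) / Real.sqrt k * (incrCoeff a (Real.log k) n n - 2)|
      ≤ ∑ k ∈ weilPrimeIndex a, |(Λ k : ℝ) / Real.sqrt k * (incrCoeff a (Real.log k) n n - 2)| :=
        Finset.abs_sum_le_sum_abs _ _
    _ ≤ ∑ k ∈ weilPrimeIndex a, (Λ k : ℝ) / Real.sqrt k * 2 :=
        Finset.sum_le_sum fun k hk ↦ by
          rw [abs_mul, abs_of_nonneg (div_nonneg ArithmeticFunction.vonMangoldt_nonneg (Real.sqrt_nonneg _))]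
          refine mul_le_mul_of_nonneg_left ?_ (div_nonneg ArithmeticFunction.vonMangoldt_nonneg (Real.sqrt_nonneg _))
          rw [mem_weilPrimeIndex] at hk
          exact abs_incrCoeff_diag_sub_two_le ha (Real.log_natCast_nonneg k) hk.le n
    _ = 2 * ∑ k ∈ weilPrimeIndex a, (Λ k : ℝ) / Real.sqrt k := by
        rw [← Finset.sum_mul]; ring

end Summit.RiemannHypothesis.RiemannHypothesis.Theorems.WeilFormatC

end
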